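import Summits.QuantumFields.YangMills.Theorems.UnitScaleTiltProp8HalvingDressingLetter
import Literature.MathematicalPhysics.QuantumFieldTheory.Balaban1983to89.BlockAveragingEMLProp2
import HarnessLib

/-!
# Route `UnitScaleTilt`, crux K1 child «MinimiserStabilityRegPr» (stmt-QuantumFields-19200), registered stub V2′ `stub_halvingStep`
# (skeletons v8 5b4e846794b80374 ∕ v10 `BirthV10`) — **CURRENT CONSERVATION FOR THE DRESSING CURRENTS, I: FLAT NOETHER — `d*(CC Z) = 0` IDENTICALLY**
# (★★OWNER g26 RULING №4 discriminator (d3) ∕ RULING №5 «CONTINUE: (N-flat) — GO»; the covariant twin (N-cov-A) is typed and held per RULING №5)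

Cell `ym3-torus` (HUMAN RULING D-0037, YM ladder rung R3 — continuum SU(2) YM₃ on the torus is a RUNG, not the Clay problem), width seat
`ym-ust-19200-w6` gen 0 (D-0154 (3c)).  `--supports stmt-QuantumFields-19200 --as helper`; def-free, 0 sorry, standard axioms.

WHY.  In the M2 knit (✓ p607120 `HalvingDressingLetter`) the dressing term of the (165)-A₁ current is `E = −½·CC(H(D Y)) − ½·T_Yᵀ[CC(ΨY)] − T_Yᵀ[W₀(ΨY)]` with the
flat curl–curl `CC Z b = η⁻²Σ_p σ(p,b)•Φ_p(Z)`.  OWNER RULING g26-№4 (the (X2-C′) kernel row is false k-uniformly at the base-point bonds: the derivative of the chart's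
averaging map has a COARSE PURE GAUGE component of first order) asks which parts of `E` see a pure gauge at all.  THIS FILE answers for the second current:
`CC Z` annihilates EVERY flat pure gauge `dφ(b) = φ(b₊) − φ(b₋)` (matrix-valued `φ`, any trace), for EVERY field `Z` — no criticality, no smallness — because
`⟨CC Z, dφ⟩ = η⁻²Σ_p tr(Φ_p(Z)·Φ_p(dφ))` (summation by parts, `HalvingDressingLetter.sum_trace_plaq_mul`) and `Φ_p(dφ) = 0` (curl ∘ grad = 0).  Hence a coarse
pure gauge routed by a gauge-natural `H` into a fine pure gauge contributes NOTHING to `E₂ = −½·T_Yᵀ[CC(ΨY)]`; only `E₃ = −T_Yᵀ[W₀(ΨY)]` needs the covariant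
identity (`W₀` alone is not conserved; `W₀ + ½CC` is covariantly conserved — the link-currency statement is ✓ `Prop8Criticality.lin_gaugeDir_eq_zero`).

WHAT THIS FILE PROVES (no definition, no sorry; level-0 bonds of any `P`, `M₂(ℂ)`-valued fields):
* `plaq_grad_eq_zero` (`Φ_p(dφ) = 0`; translations commute by `BlockAveragingEMLProp2.shift_shift_comm`),
* ★ **`curlCurl_pairing_grad_eq_zero`** — `∀ η Z φ, Σ_b tr(CC Z b · (φ b.tgt − φ b.src)) = 0`.
HONEST SCOPE.  Pure lattice algebra; NOT a claim about the stub, the crux, the rung or the mass gap; no summit statement is proved by this seat.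

References: T. Bałaban, CMP **96** (1984) 223–250 [Balaban1984PropagatorsII] (2.19) p.226 (`∂*∂`); CMP **102** (1985) 277–309 [Balaban1985Variational]
(87)–(88) p.291, (127) p.297.
-/

set_option autoImplicit false

noncomputable section

open scoped BigOperators Matrix Matrix.Norms.L2Operator
open NormedSpace

namespace Summit.QuantumFields.YangMills.Theorems.HalvingDressingLetter

open Literature.MathematicalPhysics.QuantumFieldTheory.Balaban1983to89
open BlockAveragingEMLProp2 (shift_shift_comm)

/-! ## §1 Flat Noether: the curl–curl current annihilates every pure gauge, identically -/

section Flat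

variable {P : Params}

/-- **THE PLAQUETTE FORM KILLS PURE GAUGES**: `Φ_p(dφ) = 0` for `dφ(b) = φ(b₊) − φ(b₋)`, any matrix-valued site function `φ` (curl ∘ grad = 0;
real-scalar twins: `B12Pairing543.curl_grad`, P2's `dcE_comp_dE`). [folklore] -/
theorem plaq_grad_eq_zero (φ : Site P 0 → Matrix (Fin 2) (Fin 2) ℂ) (p : Plaq P 0) :
    ((fun b : PBond P 0 => φ b.tgt - φ b.src) ⟨p.src, p.μ⟩ + (fun b : PBond P 0 => φ b.tgt - φ b.src) ⟨p.src.shift p.μ, p.ν⟩ -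
        (fun b : PBond P 0 => φ b.tgt - φ b.src) ⟨p.src.shift p.ν, p.μ⟩ - (fun b : PBond P 0 => φ b.tgt - φ b.src) ⟨p.src, p.ν⟩) = 0 := by
  simp only [PBond.tgt, shift_shift_comm p.src p.μ p.ν]
  abel

/-- ★ **FLAT NOETHER FOR THE SECOND DRESSING CURRENT — `d*(CC Z) = 0` IDENTICALLY**: for EVERY field `Z` and EVERY matrix-valued site function `φ`,
`Σ_b tr(CC Z b · (φ(b₊) − φ(b₋))) = 0`, `CC Z b = η⁻²Σ_p σ(p,b)•Φ_p(Z)` the flat curl–curl of the M2 knit — no criticality, no smallness, no trace condition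
(`⟨CC Z, dφ⟩ = η⁻²Σ_p tr(Φ_p(Z)Φ_p(dφ))` by `sum_trace_plaq_mul`, and `Φ_p(dφ) = 0`).  Consequence for OWNER RULING g26-№4 (R-c): a coarse pure gauge routed by a
gauge-natural `H` into a fine pure gauge `d(Tψ ⊗ m)` pairs to ZERO against `CC(ΨY)` — the `E₂` junction loses nothing. [cite: Balaban1984PropagatorsII, (2.19) p.226; Balaban1985Variational, (87)-(88) p.291] -/
theorem curlCurl_pairing_grad_eq_zero (η : ℝ) (Z : PBond P 0 → Matrix (Fin 2) (Fin 2) ℂ) (φ : Site P 0 → Matrix (Fin 2) (Fin 2) ℂ) :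
    ∑ b : PBond P 0, Matrix.trace ((((η : ℂ) ^ 2)⁻¹ • ∑ p : Plaq P 0, ((Pi.single b (1 : ℂ) : PBond P 0 → ℂ) ⟨p.src, p.μ⟩ + (Pi.single b (1 : ℂ) : PBond P 0 → ℂ) ⟨p.src.shift p.μ, p.ν⟩ - (Pi.single b (1 : ℂ) : PBond P 0 → ℂ) ⟨p.src.shift p.ν, p.μ⟩ - (Pi.single b (1 : ℂ) : PBond P 0 → ℂ) ⟨p.src, p.ν⟩) • (Z ⟨p.src, p.μ⟩ + Z ⟨p.src.shift p.μ, p.ν⟩ - Z ⟨p.src.shift p.ν, p.μ⟩ - Z ⟨p.src, p.ν⟩)) * (φ b.tgt - φ b.src)) = 0 := by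
  have key := sum_trace_plaq_mul Z (fun b : PBond P 0 => φ b.tgt - φ b.src)
  have hzero : ∑ p : Plaq P 0, Matrix.trace ((Z ⟨p.src, p.μ⟩ + Z ⟨p.src.shift p.μ, p.ν⟩ - Z ⟨p.src.shift p.ν, p.μ⟩ - Z ⟨p.src, p.ν⟩) *
      ((fun b : PBond P 0 => φ b.tgt - φ b.src) ⟨p.src, p.μ⟩ + (fun b : PBond P 0 => φ b.tgt - φ b.src) ⟨p.src.shift p.μ, p.ν⟩ -
        (fun b : PBond P 0 => φ b.tgt - φ b.src) ⟨p.src.shift p.ν, p.μ⟩ - (fun b : PBond P 0 => φ b.tgt - φ b.src) ⟨p.src, p.ν⟩)) = 0 :=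
    Finset.sum_eq_zero fun p _ => by rw [plaq_grad_eq_zero φ p, Matrix.mul_zero, Matrix.trace_zero]
  rw [key] at hzero
  simp only [Matrix.smul_mul, Matrix.trace_smul, ← Finset.smul_sum]
  rw [hzero, smul_zero]

end Flat

/-! ## §2 (v1.1, appended per ★★OWNER g26 RULING №6 (S7)) Covariant Noether in the A-chart currency: the first variation of `𝒮_η` vanishes along every gauge direction, at EVERY `A` -/

section Covariant

variable {P : Params}

/-- `Matrix.trace` of a differentiable matrix curve. [folklore] -/
theorem hasDerivAt_trace_comp {f : ℂ → Matrix (Fin 2) (Fin 2) ℂ} {f' : Matrix (Fin 2) (Fin 2) ℂ} {t : ℂ} (hf : HasDerivAt f f' t) :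
    HasDerivAt (fun s => Matrix.trace (f s)) (Matrix.trace f') t := by
  have h := (LinearMap.toContinuousLinearMap (Matrix.traceLinearMap (Fin 2) ℂ ℂ)).hasFDerivAt.comp_hasDerivAt t hf
  simpa [Function.comp_def] using h

/-- **THE PLAQUETTE TELESCOPING**: the gauge variation of a plaquette product `U₁U₂V₃V₄` (links varied by `l(b₋)·U − U·l(b₊)`, reversed links by
`l(b₊)·V − V·l(b₋)`) is the commutator `[l₀, U₁U₂V₃V₄]`, whose trace vanishes. [folklore] -/
theorem trace_plaq_gaugeVariation_eq_zero (c : ℂ) (U₁ U₂ V₃ V₄ l₀ l₁ l₂ l₃ : Matrix (Fin 2) (Fin 2) ℂ) :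
    Matrix.trace (((c • (l₀ * U₁ - U₁ * l₁) * U₂ + U₁ * (c • (l₁ * U₂ - U₂ * l₂))) * V₃ + U₁ * U₂ * (c • (l₂ * V₃ - V₃ * l₃))) * V₄
        + U₁ * U₂ * V₃ * (c • (l₃ * V₄ - V₄ * l₀))) = 0 := by
  have key : ((c • (l₀ * U₁ - U₁ * l₁) * U₂ + U₁ * (c • (l₁ * U₂ - U₂ * l₂))) * V₃ + U₁ * U₂ * (c • (l₂ * V₃ - V₃ * l₃))) * V₄
        + U₁ * U₂ * V₃ * (c • (l₃ * V₄ - V₄ * l₀)) = c • (l₀ * (U₁ * U₂ * V₃ * V₄) - (U₁ * U₂ * V₃ * V₄) * l₀) := by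
    simp only [smul_sub, Matrix.smul_mul, Matrix.mul_smul, Matrix.mul_sub, Matrix.sub_mul, Matrix.add_mul, Matrix.mul_assoc]
    abel
  rw [key, Matrix.trace_smul, Matrix.trace_sub, Matrix.trace_mul_comm, sub_self, smul_zero]

/-- ★★ **COVARIANT NOETHER FOR THE WILSON ACTION IN THE FLAT EXPONENTIAL CHART, AT EVERY `A`** (not only at critical points): if `δ` is a gauge direction at
`A` generated by the site function `λ` — i.e. the links move as under `U(b) ↦ g(b₋)U(b)g(b₊)⁻¹`, `g = exp(tλ)` to first order:
`d/dt exp(iη(A + tδ)(b))|₀ = iη(λ(b₋)·e^{iηA(b)} − e^{iηA(b)}·λ(b₊))` and the reversed-link twin — then `D𝒮_η(A)[δ] = 0` for the complexified Wilson action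
`𝒮_η(A) = Σ_p (1 − ½tr(e^{iηA₁}e^{iηA₂}e^{−iηA₃}e^{−iηA₄}))` of `FlatActionGradient` (trace of a commutator per plaquette; no unitarity, no trace condition on `A` or `λ`).
The link-currency twin at `SU(2)` configurations is ✓ `Prop8Criticality.lin_gaugeDir_eq_zero`. [cite: Balaban1985Averaging, (12) p.19; Balaban1985Variational, (99) p.293, (127) p.297] -/
theorem fderiv_wilson_gaugeDir_eq_zero (η : ℝ) (A δ : PBond P 0 → Matrix (Fin 2) (Fin 2) ℂ) (lam : Site P 0 → Matrix (Fin 2) (Fin 2) ℂ)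
    (hU : ∀ b : PBond P 0, HasDerivAt (fun t : ℂ => exp ((Complex.I * (η : ℂ)) • (A b + t • δ b)))
      ((Complex.I * (η : ℂ)) • (lam b.src * exp ((Complex.I * (η : ℂ)) • A b) - exp ((Complex.I * (η : ℂ)) • A b) * lam b.tgt)) 0)
    (hV : ∀ b : PBond P 0, HasDerivAt (fun t : ℂ => exp (-((Complex.I * (η : ℂ)) • (A b + t • δ b))))
      ((Complex.I * (η : ℂ)) • (lam b.tgt * exp (-((Complex.I * (η : ℂ)) • A b)) - exp (-((Complex.I * (η : ℂ)) • A b)) * lam b.src)) 0)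
    (hSd : DifferentiableAt ℂ (fun A : PBond P 0 → Matrix (Fin 2) (Fin 2) ℂ => (∑ p : Plaq P 0, (1 - (2 : ℂ)⁻¹ * Matrix.trace (exp ((Complex.I * (η : ℂ)) • A ⟨p.src, p.μ⟩) * exp ((Complex.I * (η : ℂ)) • A ⟨p.src.shift p.μ, p.ν⟩) * exp (-((Complex.I * (η : ℂ)) • A ⟨p.src.shift p.ν, p.μ⟩)) * exp (-((Complex.I * (η : ℂ)) • A ⟨p.src, p.ν⟩)))))) A) :
    fderiv ℂ (fun A : PBond P 0 → Matrix (Fin 2) (Fin 2) ℂ => (∑ p : Plaq P 0, (1 - (2 : ℂ)⁻¹ * Matrix.trace (exp ((Complex.I * (η : ℂ)) • A ⟨p.src, p.μ⟩) * exp ((Complex.I * (η : ℂ)) • A ⟨p.src.shift p.μ, p.ν⟩) * exp (-((Complex.I * (η : ℂ)) • A ⟨p.src.shift p.ν, p.μ⟩)) * exp (-((Complex.I * (η : ℂ)) • A ⟨p.src, p.ν⟩)))))) A δ = 0 := by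
  have hline : HasDerivAt (fun t : ℂ => A + t • δ) δ 0 := by
    simpa using ((hasDerivAt_id (0 : ℂ)).smul_const δ).const_add A
  have h1 : HasDerivAt (fun t : ℂ => (fun A : PBond P 0 → Matrix (Fin 2) (Fin 2) ℂ => (∑ p : Plaq P 0, (1 - (2 : ℂ)⁻¹ * Matrix.trace (exp ((Complex.I * (η : ℂ)) • A ⟨p.src, p.μ⟩) * exp ((Complex.I * (η : ℂ)) • A ⟨p.src.shift p.μ, p.ν⟩) * exp (-((Complex.I * (η : ℂ)) • A ⟨p.src.shift p.ν, p.μ⟩)) * exp (-((Complex.I * (η : ℂ)) • A ⟨p.src, p.ν⟩)))))) (A + t • δ)) (fderiv ℂ (fun A : PBond P 0 → Matrix (Fin 2) (Fin 2) ℂ => (∑ p : Plaq P 0, (1 - (2 : ℂ)⁻¹ * Matrix.trace (exp ((Complex.I * (η : ℂ)) • A ⟨p.src, p.μ⟩) * exp ((Complex.I * (η : ℂ)) • A ⟨p.src.shift p.μ, p.ν⟩) * exp (-((Complex.I * (η : ℂ)) • A ⟨p.src.shift p.ν, p.μ⟩)) * exp (-((Complex.I * (η : ℂ)) • A ⟨p.src,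 p.ν⟩)))))) A δ) 0 := by
    have hSd' : DifferentiableAt ℂ (fun A : PBond P 0 → Matrix (Fin 2) (Fin 2) ℂ => (∑ p : Plaq P 0, (1 - (2 : ℂ)⁻¹ * Matrix.trace (exp ((Complex.I * (η : ℂ)) • A ⟨p.src, p.μ⟩) * exp ((Complex.I * (η : ℂ)) • A ⟨p.src.shift p.μ, p.ν⟩) * exp (-((Complex.I * (η : ℂ)) • A ⟨p.src.shift p.ν, p.μ⟩)) * exp (-((Complex.I * (η : ℂ)) • A ⟨p.src, p.ν⟩)))))) (A + (0 : ℂ) • δ) := by simpa only [zero_smul, add_zero] using hSd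
    have h := hSd'.hasFDerivAt.comp_hasDerivAt (0 : ℂ) hline
    simpa only [Function.comp_def, zero_smul, add_zero] using h
  have h2 : HasDerivAt (fun t : ℂ => (fun A : PBond P 0 → Matrix (Fin 2) (Fin 2) ℂ => (∑ p : Plaq P 0, (1 - (2 : ℂ)⁻¹ * Matrix.trace (exp ((Complex.I * (η : ℂ)) • A ⟨p.src, p.μ⟩) * exp ((Complex.I * (η : ℂ)) • A ⟨p.src.shift p.μ, p.ν⟩) * exp (-((Complex.I * (η : ℂ)) • A ⟨p.src.shift p.ν, p.μ⟩)) * exp (-((Complex.I * (η : ℂ)) • A ⟨p.src, p.ν⟩)))))) (A + t • δ)) 0 0 := by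
    have e : (fun t : ℂ => (fun A : PBond P 0 → Matrix (Fin 2) (Fin 2) ℂ => (∑ p : Plaq P 0, (1 - (2 : ℂ)⁻¹ * Matrix.trace (exp ((Complex.I * (η : ℂ)) • A ⟨p.src, p.μ⟩) * exp ((Complex.I * (η : ℂ)) • A ⟨p.src.shift p.μ, p.ν⟩) * exp (-((Complex.I * (η : ℂ)) • A ⟨p.src.shift p.ν, p.μ⟩)) * exp (-((Complex.I * (η : ℂ)) • A ⟨p.src, p.ν⟩)))))) (A + t • δ)) = fun t : ℂ => ∑ p : Plaq P 0, (1 - (2 : ℂ)⁻¹ * Matrix.trace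
        (exp ((Complex.I * (η : ℂ)) • (A ⟨p.src, p.μ⟩ + t • δ ⟨p.src, p.μ⟩)) * exp ((Complex.I * (η : ℂ)) • (A ⟨p.src.shift p.μ, p.ν⟩ + t • δ ⟨p.src.shift p.μ, p.ν⟩)) * exp (-((Complex.I * (η : ℂ)) • (A ⟨p.src.shift p.ν, p.μ⟩ + t • δ ⟨p.src.shift p.ν, p.μ⟩))) * exp (-((Complex.I * (η : ℂ)) • (A ⟨p.src, p.ν⟩ + t • δ ⟨p.src, p.ν⟩))))) := by
      funext t; rfl
    rw [e]
    have h2' : HasDerivAt (fun t : ℂ => ∑ p : Plaq P 0, (1 - (2 : ℂ)⁻¹ * Matrix.trace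
        (exp ((Complex.I * (η : ℂ)) • (A ⟨p.src, p.μ⟩ + t • δ ⟨p.src, p.μ⟩)) * exp ((Complex.I * (η : ℂ)) • (A ⟨p.src.shift p.μ, p.ν⟩ + t • δ ⟨p.src.shift p.μ, p.ν⟩)) * exp (-((Complex.I * (η : ℂ)) • (A ⟨p.src.shift p.ν, p.μ⟩ + t • δ ⟨p.src.shift p.ν, p.μ⟩))) * exp (-((Complex.I * (η : ℂ)) • (A ⟨p.src, p.ν⟩ + t • δ ⟨p.src, p.ν⟩))))))
        (∑ _p : Plaq P 0, (0 : ℂ)) 0 := by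
      refine HasDerivAt.fun_sum fun p _ => ?_
      have hprod := (((hU ⟨p.src, p.μ⟩).fun_mul (hU ⟨p.src.shift p.μ, p.ν⟩)).fun_mul (hV ⟨p.src.shift p.ν, p.μ⟩)).fun_mul (hV ⟨p.src, p.ν⟩)
      simp only [zero_smul, add_zero] at hprod
      have htr := ((hasDerivAt_const (0 : ℂ) (1 : ℂ)).fun_sub ((hasDerivAt_trace_comp hprod).const_mul ((2 : ℂ)⁻¹)))
      refine htr.congr_deriv ?_
      have hz := trace_plaq_gaugeVariation_eq_zero (Complex.I * (η : ℂ)) (exp ((Complex.I * (η : ℂ)) • A ⟨p.src, p.μ⟩)) (exp ((Complex.I * (η : ℂ)) • A ⟨p.src.shift p.μ, p.ν⟩)) (exp (-((Complex.I * (η : ℂ)) • A ⟨p.src.shift p.ν, p.μ⟩))) (exp (-((Complex.I * (η : ℂ)) • A ⟨p.src, p.ν⟩)))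
        (lam p.src) (lam (p.src.shift p.μ)) (lam ((p.src.shift p.ν).shift p.μ)) (lam (p.src.shift p.ν))
      simp only [PBond.tgt, shift_shift_comm p.src p.μ p.ν] at hz ⊢
      rw [hz, mul_zero, sub_zero]
    simpa only [Finset.sum_const_zero] using h2'
  exact h1.unique h2

/-- ★★ **THE SAME IN THE TRACE-PAIRING CURRENCY OF THE (165)-A₁ CHAIN**: with the gradient identity of ✓ `FlatActionGradient.exists_gradient_action`
(`D𝒮_η(A)[δ] = (η²/2)Σ_p tr(Φ_p(A)Φ_p(δ)) + η⁴Σ_b tr(W₀(A)_bδ_b)`), the FULL current `½·CC(A) + W₀(A)` pairs to zero with every gauge direction `δ` at `A`: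
`(η²/2)Σ_p tr(Φ_p(A)Φ_p(δ)) + η⁴Σ_b tr(W₀(A)_b δ_b) = 0` — covariant current conservation `D_A^*(W₀ + ½CC)(A) = 0` at EVERY `A` (print (127) uses it only at the
critical point).  `W₀` alone is NOT covariantly conserved; `½CC` alone is FLATLY conserved (`curlCurl_pairing_grad_eq_zero`).
[cite: Balaban1985Variational, (99) p.293, (127) p.297; Balaban1985Averaging, (12) p.19] -/
theorem tracePairing_gaugeDir_eq_zero (η : ℝ) (A δ : PBond P 0 → Matrix (Fin 2) (Fin 2) ℂ) (lam : Site P 0 → Matrix (Fin 2) (Fin 2) ℂ)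
    (W₀ : (PBond P 0 → Matrix (Fin 2) (Fin 2) ℂ) → (PBond P 0 → Matrix (Fin 2) (Fin 2) ℂ))
    (hSd : Differentiable ℂ (fun A : PBond P 0 → Matrix (Fin 2) (Fin 2) ℂ => (∑ p : Plaq P 0, (1 - (2 : ℂ)⁻¹ * Matrix.trace (exp ((Complex.I * (η : ℂ)) • A ⟨p.src, p.μ⟩) * exp ((Complex.I * (η : ℂ)) • A ⟨p.src.shift p.μ, p.ν⟩) * exp (-((Complex.I * (η : ℂ)) • A ⟨p.src.shift p.ν, p.μ⟩)) * exp (-((Complex.I * (η : ℂ)) • A ⟨p.src, p.ν⟩)))))))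
    (hgrad : ∀ A δ : PBond P 0 → Matrix (Fin 2) (Fin 2) ℂ, fderiv ℂ (fun A : PBond P 0 → Matrix (Fin 2) (Fin 2) ℂ => (∑ p : Plaq P 0, (1 - (2 : ℂ)⁻¹ * Matrix.trace (exp ((Complex.I * (η : ℂ)) • A ⟨p.src, p.μ⟩) * exp ((Complex.I * (η : ℂ)) • A ⟨p.src.shift p.μ, p.ν⟩) * exp (-((Complex.I * (η : ℂ)) • A ⟨p.src.shift p.ν, p.μ⟩)) * exp (-((Complex.I * (η : ℂ)) • A ⟨p.src, p.ν⟩)))))) A δ =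
      ((η : ℂ) ^ 2 / 2) * ∑ p : Plaq P 0, Matrix.trace ((A ⟨p.src, p.μ⟩ + A ⟨p.src.shift p.μ, p.ν⟩ - A ⟨p.src.shift p.ν, p.μ⟩ - A ⟨p.src, p.ν⟩) * (δ ⟨p.src, p.μ⟩ + δ ⟨p.src.shift p.μ, p.ν⟩ - δ ⟨p.src.shift p.ν, p.μ⟩ - δ ⟨p.src, p.ν⟩)) + (η : ℂ) ^ 4 * ∑ b : PBond P 0, Matrix.trace (W₀ A b * δ b))
    (hU : ∀ b : PBond P 0, HasDerivAt (fun t : ℂ => exp ((Complex.I * (η : ℂ)) • (A b + t • δ b)))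
      ((Complex.I * (η : ℂ)) • (lam b.src * exp ((Complex.I * (η : ℂ)) • A b) - exp ((Complex.I * (η : ℂ)) • A b) * lam b.tgt)) 0)
    (hV : ∀ b : PBond P 0, HasDerivAt (fun t : ℂ => exp (-((Complex.I * (η : ℂ)) • (A b + t • δ b))))
      ((Complex.I * (η : ℂ)) • (lam b.tgt * exp (-((Complex.I * (η : ℂ)) • A b)) - exp (-((Complex.I * (η : ℂ)) • A b)) * lam b.src)) 0) :
    ((η : ℂ) ^ 2 / 2) * ∑ p : Plaq P 0, Matrix.trace ((A ⟨p.src, p.μ⟩ + A ⟨p.src.shift p.μ, p.ν⟩ - A ⟨p.src.shift p.ν, p.μ⟩ - A ⟨p.src, p.ν⟩) * (δ ⟨p.src, p.μ⟩ + δ ⟨p.src.shift p.μ, p.ν⟩ - δ ⟨p.src.shift p.ν, p.μ⟩ - δ ⟨p.src, p.ν⟩)) + (η : ℂ) ^ 4 * ∑ b : PBond P 0, Matrix.trace (W₀ A b * δ b) = 0 := by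
  rw [← hgrad A δ]
  exact fderiv_wilson_gaugeDir_eq_zero η A δ lam hU hV (hSd A)

end Covariant


end Summit.QuantumFields.YangMills.Theorems.HalvingDressingLetter

end
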